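import Summits.ABC.IUTFork.Cor312NegLogThetaUpperPrVol
import Summits.ABC.IUTFork.Cor312PinnedHonestInflation
import HarnessLib

/-!
# [IUTchIII] Cor. 3.12 — the DIOPHANTINE CONTENT of the typed Statement at the print-normalised assembled real
# setting with pilot regions read off REALISING ideles (`Real.settingPrVolSharp`): the typed Corollary implies an
# explicit Szpiro-type inequality for the pilot datum, with the cell's (existential) inflation constant

PROOF-ONLY support piece of the abc-iut cell (Cor. 3.12 cone, D-0067; seat abc-iut-w4-d107, gen 4; part 6 of the
`Cor312NegLogThetaUpperPrVol*` chain, sequel of part 2 `Cor312NegLogThetaUpperPrVol`). TAKES NO SIDE on [IUTchIII]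
Cor. 3.12; theorems only, 0 `def`s, no new `Prop` fact. At abc-iut-c312-7's `Real.settingPrVolSharp` with Θ-ideles and
`q`-ideles REALISING `P_Θ`, `P_q` in Dupuy–Hilado's normalisation (3.4) (`log ‖t_{Θ,i+1,v}‖ = −P_{Θ,i+1}(v)·ln|κ(v)|/n_v`,
`log ‖t_{q,v}‖ = −P_q(v)·ln|κ(v)|/n_v`; `P_{Θ,j} = j²·P_q`, abc-iut-c312-3 `PilotData.thetaPilot_eq_smul`; inhabited iff
`2l ∣ ord_v(q_v)` on `S`, abc-iut-c312-3 / abc-iut-C-cert-3 — plan C-R16), abc-iut-c312-7 proved `−|log(q)| = −deĝ(P_q)`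
(`negLogQ_settingPrVolSharp`) and `Statement ↔ ↑(−deĝ(P_q)) ≤ −|log(Θ)|`. Parts 2–3 bound `−|log(Θ)|` by
`C(X, logv) + PN_i(Σ_p log ρ_i(p))` for every dominating family. THIS FILE combines the two:

* **`statement_settingPrVolSharp_realising_imp_szpiro`**: `∀ X hlog, ∃ C, ∀ ⟨context⟩ ⟨realising ideles⟩`, for every
  nonnegative family `d_p ≤ min_{v | p} P_q(v)·ln|κ(v)|/n_v` (a uniform lower bound on the `q`-depth RATE over the places
  above `p`; `d_p = 0` is forced when some place above `p` is good) and every finite set of primes `U`: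
  `Statement ⟹ κ·Σ_{p∈U} d_p − deĝ(P_q)/[F:ℚ] ≤ C`, `κ = (ℓ⋇+1)(2ℓ⋇+1)/6`. For `F = ℚ` (one place per prime, `n_v = 1`,
  `d_p := P_q(p)·log p` exact, `U` = the primes under `S`) this reads `(κ − 1)·deĝ(P_q) ≤ C`: **the typed [IUTchIII]
  Cor. 3.12 at the genuine print-normalised setting of a pilot datum implies an explicit Szpiro-type bound on its
  `q`-pilot degree** — the shape of [IUTchIV] Thm. 1.10 (Cor. 3.12 ⟹ a height bound), kernel-checked at the VERBATIM
  setting with the cell's existential hull-inflation constant `C(X, logv)` in place of print's Step (v)–(viii)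
  constants ([IUTchIV] pp. 27–30); equivalently, pilot data violating the bound would refute the typed Corollary at
  their own genuine setting (none asserted to exist).
HONEST SCOPE: (Ind2) as typed at the real setting (`Real.ismDH`); sharp (Ind3) reading; trivial archimedean container;
`C` is existential (sandwich radii of the log-shell lattices), not print's constant; at primes of bad mass `< 1` the
admissible `d_p` is `0` (the bound drops the Θ-gain there, abc-iut-S7 `hullEstimateOf_depthUniform_dichotomy`).
Nothing here asserts or denies Cor. 3.12 or abc. typed ≠ proved; instantiated ≠ endorsed.
[claim: Mochizuki2012, status: disputed] [cite: DupuyHilado2025, §3.3, §3.4, Thm. 3.10.1, §4.10]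
[cite: ScholzeStix2018, §2.2 pp. 9–10]
-/

noncomputable section

open Set Function NumberField IsDedekindDomain
open scoped Pointwise

namespace Summit.ABC

namespace IUTFork

namespace Thm311

namespace Real

open Cor312 Cor312.Setting Cor312Vol Literature.IUT.LogThetaLattice Literature.IUT.LogVolume

variable {F : Type} [Field F] [NumberField F] (X : PilotData F) {logv : PadicLogs F} (hlog : LogvAnalytic logv)

/-- **THE TYPED COROLLARY 3.12 AT REALISING IDELES IMPLIES AN EXPLICIT SZPIRO-TYPE INEQUALITY** (module docstring):
`∃ C(X, logv)` such that, for every Thm-3.11 context and every Θ- and `q`-ideles realising `P_Θ`/`P_q`, every nonnegative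
depth-rate minorant `d_p ≤ P_q(v)·ln|κ(v)|/n_v` (`v | p`) and every finite set of primes `U`:
`Statement ⟹ κ·Σ_{p∈U} d_p − deĝ(P_q)/[F:ℚ] ≤ C`, `κ = (ℓ⋇+1)(2ℓ⋇+1)/6`. [claim: Mochizuki2012, status: disputed] -/
theorem statement_settingPrVolSharp_realising_imp_szpiro :
    ∃ C : ℝ,
      ∀ (M : Type) [Field M] [NumberField M]
        (archPk : ∀ (j : (thetaIndex X).Label) (vQ : (thetaIndex X).VQ), Set ((logShellsDH X logv).Packet j vQ))
        (archSub : ∀ (j : (thetaIndex X).Label) (v : (thetaIndex X).V),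
          Set ((logShellsDH X logv).Packet j ((thetaIndex X).over v)))
        (Ψ : ℤ → ∀ v : (thetaIndex X).V, v ∈ (thetaIndex X).Vbad → Set ((logShellsDH X logv).StarPacket v))
        (act : ℤ → ∀ v : (thetaIndex X).V, v ∈ (thetaIndex X).Vbad →
          (logShellsDH X logv).StarPacket v → Module.End ℚ ((logShellsDH X logv).StarPacket v))
        (Mmod : ℤ → ∀ j : (thetaIndex X).LabelStar, Set ((logShellsDH X logv).GlobalPacket j.1))
        (region : ℤ → ∀ j : (thetaIndex X).LabelStar, FinDivisor M → ∀ vQ : (thetaIndex X).VQ,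
          Set ((logShellsDH X logv).Packet j.1 vQ))
        (n : ℤ) (HT : Type) (LogLink : HT → HT → Type) (IsFull : ∀ {s t : HT}, LogLink s t → Prop)
        (lat : LGPGaussianLogThetaLattice LogLink IsFull)
        (Frd : Type) (IsoF : Frd → Frd → Type) (Ob : Frd → Type) (realify : Frd → Frd) (Strip : Type)
        (IsoS : Strip → Strip → Type) (Mv : ∀ v : (thetaIndex X).V, v ∈ (thetaIndex X).Vbad → Type)
        (_ : ∀ v h, Monoid (Mv v h))
        (sig : GlobalLGPFrobenioidSignature (thetaIndex X).lstar (thetaIndex X).V (· ∈ (thetaIndex X).Vbad)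
          Frd IsoF Ob realify Strip IsoS Mv)
        (split : SplittingMonoids Mv) (ObΔ : Type) (N : ∀ v : (thetaIndex X).V, v ∈ (thetaIndex X).Vbad → Type)
        (_ : ∀ v h, Monoid (N v h)) (qData : QPilotData ObΔ N)
        (tq : ∀ (pp : Nat.Primes) (x : (thetaIndex X).Fibre (.inr pp)),
          haveI : Fact (pp : ℕ).Prime := ⟨pp.2⟩; kOf X pp.1 x)
        (t : ∀ (pp : Nat.Primes) (_ : Fin X.lstar) (x : (thetaIndex X).Fibre (.inr pp)),
          haveI : Fact (pp : ℕ).Prime := ⟨pp.2⟩; kOf X pp.1 x)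
        (ht0 : ∀ pp i x, t pp i x ≠ 0)
        (_ : ∀ (pp : Nat.Primes) (i : Fin X.lstar) (x : (thetaIndex X).Fibre (.inr pp)),
          haveI : Fact (pp : ℕ).Prime := ⟨pp.2⟩
          Real.log ‖t pp i x‖ = -(X.thetaPilot i (placeOf X pp.1 x)) * logNorm F (placeOf X pp.1 x) /
            localDegree F (placeOf X pp.1 x))
        (htq0 : ∀ pp x, tq pp x ≠ 0)
        (htq1 : ∀ (pp : Nat.Primes) (x : (thetaIndex X).Fibre (.inr pp)),
          haveI : Fact (pp : ℕ).Prime := ⟨pp.2⟩; placeOf X pp.1 x ∉ X.S → ‖tq pp x‖ = 1)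
        (_ : ∀ (pp : Nat.Primes) (x : (thetaIndex X).Fibre (.inr pp)),
          haveI : Fact (pp : ℕ).Prime := ⟨pp.2⟩
          Real.log ‖tq pp x‖ = -(X.qPilot (placeOf X pp.1 x)) * logNorm F (placeOf X pp.1 x) /
            localDegree F (placeOf X pp.1 x))
        (d : Nat.Primes → ℝ), (∀ pp, 0 ≤ d pp) →
        (∀ (pp : Nat.Primes) (x : (thetaIndex X).Fibre (.inr pp)),
          haveI : Fact (pp : ℕ).Prime := ⟨pp.2⟩
          d pp ≤ X.qPilot (placeOf X pp.1 x) * logNorm F (placeOf X pp.1 x) / localDegree F (placeOf X pp.1 x)) →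
        ∀ U : Finset Nat.Primes,
        (settingPrVolSharp X hlog M archPk archSub Ψ act Mmod region n lat sig split qData tq t htq0 htq1).Statement →
          (((thetaIndex X).lstar : ℝ) + 1) * (2 * (thetaIndex X).lstar + 1) / 6 * ∑ pp ∈ U, d pp -
            FinDivisor.ndeg F X.qPilot ≤ C := by
  obtain ⟨Bad, r, R, hBad2, hBadD, hBadS, hr0, hR0, hball, hbdd⟩ := exists_bad_and_radii X hlog
  refine ⟨processionNormalized (fun i : Fin (thetaIndex X).lstar =>
    ∑ pp ∈ Bad, Real.log (((pp : ℕ) : ℝ) ^ 2 * R pp i / r pp i)), ?_⟩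
  intro M _ _ archPk archSub Ψ act Mmod region n HT LogLink IsFull lat Frd IsoF Ob realify Strip IsoS Mv _ sig split
    ObΔ N _ qData tq t ht0 ht htq0 htq1 htq d hd0 hd U hst
  set C : ℝ := processionNormalized (fun i : Fin (thetaIndex X).lstar =>
    ∑ pp ∈ Bad, Real.log (((pp : ℕ) : ℝ) ^ 2 * R pp i / r pp i)) with hCdef
  have hl : 0 < (thetaIndex X).lstar := lt_of_lt_of_le (by norm_num) (thetaIndex X).two_le_lstar
  -- the Θ-ideles realising `P_Θ = (j²·P_q)_j` are units off `S`
  have ht1 : ∀ (pp : Nat.Primes) (i : Fin X.lstar) (x : (thetaIndex X).Fibre (.inr pp)),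
      haveI : Fact (pp : ℕ).Prime := ⟨pp.2⟩; placeOf X pp.1 x ∉ X.S → ‖t pp i x‖ = 1 := by
    intro pp i x hx
    haveI : Fact (pp : ℕ).Prime := ⟨pp.2⟩
    have h := ht pp i x
    rw [X.thetaPilot_apply_of_not_mem i hx, neg_zero, zero_mul, zero_div] at h
    exact Real.eq_one_of_pos_of_log_eq_zero (norm_pos_iff.mpr (ht0 pp i x)) h
  -- the dominating family `ρ_i(p) := exp(−(i+1)²·d_p)`
  set ρ : Nat.Primes → Fin (thetaIndex X).lstar → ℝ := fun pp i => Real.exp (-((((i : ℕ) + 1 : ℕ) : ℝ) ^ 2 * d pp))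
    with hρdef
  have hρ0 : ∀ pp i, 0 < ρ pp i := fun pp i => Real.exp_pos _
  have hρ1 : ∀ pp i, ρ pp i ≤ 1 := fun pp i => by
    rw [hρdef]
    exact Real.exp_le_one_iff.mpr (neg_nonpos.mpr (mul_nonneg (sq_nonneg _) (hd0 pp)))
  have hρ : ∀ (pp : Nat.Primes) (i : Fin (thetaIndex X).lstar) (x : (thetaIndex X).Fibre (.inr pp)),
      ‖t pp i x‖ ≤ ρ pp i := by
    intro pp i x
    haveI : Fact (pp : ℕ).Prime := ⟨pp.2⟩
    have hpos : 0 < ‖t pp i x‖ := norm_pos_iff.mpr (ht0 pp i x)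
    rw [← Real.exp_log hpos, hρdef]
    refine Real.exp_le_exp.mpr ?_
    rw [ht pp i x, X.thetaPilot_eq_smul i, Finsupp.smul_apply, smul_eq_mul]
    have h1 := mul_le_mul_of_nonneg_left (hd pp x) (sq_nonneg ((((i : ℕ) + 1 : ℕ) : ℝ)))
    have h2 : ((((i : ℕ) + 1 : ℕ) : ℝ) ^ 2) * (X.qPilot (placeOf X pp.1 x) * logNorm F (placeOf X pp.1 x) /
        localDegree F (placeOf X pp.1 x)) =
        -(-((((i : ℕ) + 1 : ℝ) ^ 2) * X.qPilot (placeOf X pp.1 x)) * logNorm F (placeOf X pp.1 x) /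
          localDegree F (placeOf X pp.1 x)) := by
      push_cast; ring
    linarith
  -- the upper bound of part 2 with this family
  have hΘ := negLogTheta_settingPrVolSharp_le_of_radii X hlog M archPk archSub Ψ act Mmod region n lat sig split qData t
    tq ht0 ht1 htq0 htq1 Bad hBad2 hBadD hBadS r R hr0 hR0 hball hbdd ρ hρ0 hρ1 hρ U
  have hPN : processionNormalized (fun i : Fin (thetaIndex X).lstar => ∑ pp ∈ U, Real.log (ρ pp i)) =
      -((((thetaIndex X).lstar : ℝ) + 1) * (2 * (thetaIndex X).lstar + 1) / 6 * ∑ pp ∈ U, d pp) := by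
    have hrew : ∀ i : Fin (thetaIndex X).lstar, ∑ pp ∈ U, Real.log (ρ pp i) =
        (((((i : ℕ) + 1 : ℕ)) : ℝ) ^ 2) * -(∑ pp ∈ U, d pp) := by
      intro i
      rw [← Finset.sum_neg_distrib, Finset.mul_sum]
      refine Finset.sum_congr rfl fun pp _ => ?_
      rw [hρdef, Real.log_exp]; ring
    simp_rw [hrew]
    have hmul : ∀ (f : Fin (thetaIndex X).lstar → ℝ) (a : ℝ),
        processionNormalized (fun i => f i * a) = processionNormalized f * a := fun f a => by
      unfold processionNormalized; rw [← Finset.sum_mul, mul_div_right_comm]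
    rw [hmul, PinnedHonest.processionNormalized_labelSq hl]
    ring
  -- the `q`-side is the number `−deĝ(P_q)/[F:ℚ]` (abc-iut-c312-7)
  have hq := negLogQ_settingPrVolSharp X hlog M archPk archSub Ψ act Mmod region n lat sig split qData t tq htq0 htq1 htq
  have h2 : (settingPrVolSharp X hlog M archPk archSub Ψ act Mmod region n lat sig split qData tq t htq0 htq1).negLogQ ≤
      C + processionNormalized (fun i : Fin (thetaIndex X).lstar => ∑ pp ∈ U, Real.log (ρ pp i)) :=
    WithTop.coe_le_coe.mp (hst.2.trans hΘ)
  rw [hq, hPN] at h2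
  linarith

end Real

end Thm311

end IUTFork

end Summit.ABC

end
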